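import Summits.QuantumAdvantage.QuantumAdvantage.Theses.CubicForrelation
import Summits.QuantumAdvantage.QuantumAdvantage.Theorems.NearExactIsExact.Negative.ValueWitnesses
import Summits.QuantumAdvantage.QuantumAdvantage.Theorems.CubicForrelationNearExactIsExactCubicEvenOnFourFlat

/-!
# Weighted flat-packing certificates for `NearExactIsExact` (stmt-QuantumAdvantage-14043)

Negative-side support (B2b disprover seat `b2b-cforr-disprove-g9`, 2026-08-20).  HONEST FRAMING: the value of this file
is a kernel-checkable CERTIFICATE FORMAT plus instances (upper bounds on `max_f Φ(f,g)` over all cubic `f` for explicit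
cubic `g`), not summit progress.

## The certificate
For `g : 𝔽₂ⁿ → 𝔽₂` with Walsh spectrum `W = W_g` (on codes `y < 2ⁿ`), a *weighted flat packing* is a list of records
`(x₀, d₁, d₂, d₃, d₄, μ)`: the affine 4-flat `F = x₀ ⊕ ⟨d₁,…,d₄⟩` (16 parameters `e < 16`), required to satisfy
(i) every point of `F` lies in `supp W` and has `|W| ≥ μ`; (ii) the number of points of `F` with `W < 0` is odd;
(iii) the flats are pairwise disjoint; (iv) `Σ_y |W(y)| − 2 Σ_F μ_F ≤ T`.  **Soundness** (`fsumZ_le_of_packCheck`):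
then `Σ_y (−1)^{f(y)} W(y) ≤ T` for EVERY cubic `f`.  Proof: a cubic has even weight on every affine 4-flat
(fourth derivatives vanish; `cf_even_card_of_cubic_four` + `knf_isDegLeFun_comp`), while the sign pattern of `W` has odd
weight on each packed flat by (ii); so `f` disagrees with `sgn W` somewhere on each flat, losing at least `2μ_F` against the
capacity `Σ|W|`, and disjoint flats lose independently.  This is the weighted form of the flat certificate used by the
`n = 10` census (`CubicForrelationNearExactIsExactFlatCertificateSoundness.lean`, `partner_le_of_flatCertificate`); the checker
`packCheck` runs on the fast Walsh table (`wal`, `sigTable` of `SmallCasesWalsh.lean`) and is decided by `native_decide`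
(the file is `computational`).

## Instances
`FlatPackingSixteen.lean` (data in `FlatPackingSixteenData.lean`): two Frobenius-invariant cubics on 16 bits with
capacity `> 15/16` and no cubic partner above `15/16`.  The same checker certifies any `(g, T)` for which a packing is
found (the seat's `pack.c` emits the records); it is the f-side closing tool of the symmetric censuses of generation 9.

References: MacWilliams–Sloane 1977 Ch. 13–15 (Reed–Muller codes, even weights of `RM(3,4)`); Carlet 2021 §6.1
(idempotents / Walsh spectra); Aaronson–Ambainis 2018 §1.1.1 (forrelation).
-/

set_option linter.dupNamespace false -- D-0017: single-problem summit ⇒ `QuantumAdvantage.QuantumAdvantage` by design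

namespace Summit.QuantumAdvantage.QuantumAdvantage.Theorems.NearExactIsExact.Negative.FlatPacking

open Finset
open Literature.Computability.QuantumComplexity
open Summit.QuantumAdvantage.QuantumAdvantage.Theorems.NearExactIsExact.Negative.SmallCases
  (sgnZ wal pt sum_pt wspec sigTable wal_sigTable fsumZ forrelation_mul_eq_fsumZ)
open Summit.QuantumAdvantage.QuantumAdvantage.Theorems.CubicForrelation.NearExactIsExact
  (cf_even_card_of_cubic_four fc_deg_bxor)
open Summit.QuantumAdvantage.QuantumAdvantage.Theorems.SignedCubicForrelationNotPrBPP
  (knf_isDegLeFun_comp knf_isDegLeFun_and_const)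
open Summit.QuantumAdvantage.QuantumAdvantage.Theorems.SignedExactSliceIsLift.StubMoebius (isDegLeFun_xor isDegLeFun_and)

/-! ### Flats on codes -/

/-- A flat record `(x₀, d₁, d₂, d₃, d₄, μ)`: base code, four direction codes, claimed lower bound on `|W|`. [folklore] -/
abbrev FlatRec : Type := ℕ × ℕ × ℕ × ℕ × ℕ × ℕ

/-- The weight field `μ` of a record. [folklore] -/
def mu (c : FlatRec) : ℤ := c.2.2.2.2.2

/-- The code of the flat point with parameter `e < 16`: `x₀ ⊕ e₀d₁ ⊕ e₁d₂ ⊕ e₂d₃ ⊕ e₃d₄`. [folklore] -/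
def fcode (c : FlatRec) (e : ℕ) : ℕ :=
  c.1 ^^^ ((if e.testBit 0 then c.2.1 else 0) ^^^ ((if e.testBit 1 then c.2.2.1 else 0) ^^^
    ((if e.testBit 2 then c.2.2.2.1 else 0) ^^^ (if e.testBit 3 then c.2.2.2.2.1 else 0))))

/-- The flat of a record as a finset of codes. [folklore] -/
def fset (c : FlatRec) : Finset ℕ := (range 16).image (fcode c)

/-- The affine parametrisation `ε ↦ x₀ ⊕ Σ εᵢ dᵢ` of the flat on points of `𝔽₂ⁿ`. [folklore] -/
def fpt (n : ℕ) (c : FlatRec) (ε : Fin 4 → Bool) : Fin n → Bool := fun j =>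
  pt n c.1 j ^^ ((ε 0 && pt n c.2.1 j) ^^ ((ε 1 && pt n c.2.2.1 j) ^^
    ((ε 2 && pt n c.2.2.2.1 j) ^^ (ε 3 && pt n c.2.2.2.2.1 j))))

/-- Bits of `if b then d else 0`. [folklore] -/
theorem testBit_ite (b : Bool) (d j : ℕ) : (if b then d else 0).testBit j = (b && d.testBit j) := by
  cases b <;> simp

/-- The parametrisation at `ε = pt 4 e` is the point with code `fcode c e`. [folklore] -/
theorem fpt_pt (n : ℕ) (c : FlatRec) (e : ℕ) : fpt n c (pt 4 e) = pt n (fcode c e) := by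
  funext j
  simp only [fpt, pt, fcode, Nat.testBit_xor, testBit_ite]
  rfl

/-- **Cubics are even on 4-flats** (general `n`): `#{ε : f(x₀ ⊕ Σ εᵢdᵢ) = 1}` is even for `f` of degree `≤ 3`
(the pullback to `𝔽₂⁴` is cubic, and `RM(3,4)` has even weights). [cite: MacWilliamsSloane1977, Ch. 13 §3] -/
theorem even_card_fpt {n : ℕ} (f : (Fin n → Bool) → Bool) (hf : IsDegLeFun 3 f) (c : FlatRec) :
    Even ((univ.filter fun ε : Fin 4 → Bool => f (fpt n c ε) = true).card) :=
  cf_even_card_of_cubic_four (knf_isDegLeFun_comp hf (fpt n c) fun _ =>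
    fc_deg_bxor (isDegLeFun_const 1 _) (fc_deg_bxor (knf_isDegLeFun_and_const 0 _)
      (fc_deg_bxor (knf_isDegLeFun_and_const 1 _) (fc_deg_bxor (knf_isDegLeFun_and_const 2 _)
        (knf_isDegLeFun_and_const 3 _)))))

/-- The flat weight as a sum over the 16 parameters. [folklore] -/
theorem card_fpt_eq_sum {n : ℕ} (f : (Fin n → Bool) → Bool) (c : FlatRec) :
    (univ.filter fun ε : Fin 4 → Bool => f (fpt n c ε) = true).card =
      ∑ e ∈ range 16, if f (pt n (fcode c e)) = true then 1 else 0 := by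
  rw [card_filter, sum_pt 4]
  refine sum_congr rfl fun e _ => ?_
  rw [fpt_pt]

/-! ### The checker -/

/-- The certificate checker on the fast Walsh table of `g`: code ranges, support and weight bounds, odd sign parity
per flat, pairwise disjointness, and the budget `Σ|W| − 2Σμ ≤ T`. [folklore] -/
def packCheck (n : ℕ) (g : (Fin n → Bool) → Bool) (T : ℤ) (cert : List FlatRec) : Bool :=
  let w := (wal n (sigTable n g)).toArray
  (cert.all fun c => decide (c.1 < 2 ^ n) && decide (c.2.1 < 2 ^ n) && decide (c.2.2.1 < 2 ^ n) &&
      decide (c.2.2.2.1 < 2 ^ n) && decide (c.2.2.2.2.1 < 2 ^ n)) &&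
  (cert.all fun c => (List.range 16).all fun e =>
      decide (w[fcode c e]?.getD 0 ≠ 0) && decide (mu c ≤ |w[fcode c e]?.getD 0|)) &&
  (cert.all fun c => decide ((∑ e ∈ range 16, if w[fcode c e]?.getD 0 < 0 then (1 : ℕ) else 0) % 2 = 1)) &&
  decide (cert.Pairwise fun c c' => Disjoint (fset c) (fset c')) &&
  decide ((∑ y ∈ range (2 ^ n), |w[y]?.getD 0|) - 2 * (cert.map mu).sum ≤ T)

/-! ### Soundness -/

/-- Sign bookkeeping: `s·w = |w| − 2·[s·w < 0]·|w|` for `s = ±1`. [folklore] -/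
theorem sign_mul_eq (s w : ℤ) (hs : s = 1 ∨ s = -1) :
    s * w = |w| - 2 * (if s * w < 0 then |w| else 0) := by
  rcases hs with rfl | rfl
  · rcases le_or_gt 0 w with hw | hw
    · rw [if_neg (by linarith), abs_of_nonneg hw]; ring
    · rw [if_pos (by linarith), abs_of_neg hw]; ring
  · rcases le_or_gt w 0 with hw | hw
    · rw [if_neg (by linarith), abs_of_nonpos hw]; ring
    · rw [if_pos (by linarith), abs_of_pos hw]; ring

/-- The union of the flats of a record list. [folklore] -/
def flatUnion : List FlatRec → Finset ℕ
  | [] => ∅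
  | c :: L => fset c ∪ flatUnion L

/-- A flat disjoint from every flat of a list is disjoint from their union. [folklore] -/
theorem disjoint_flatUnion (c : FlatRec) (L : List FlatRec) (h : ∀ c' ∈ L, Disjoint (fset c) (fset c')) :
    Disjoint (fset c) (flatUnion L) := by
  induction L with
  | nil => simp [flatUnion]
  | cons c' L ih =>
    rw [flatUnion, disjoint_union_right]
    exact ⟨h c' (by simp), ih fun c'' hc'' => h c'' (by simp [hc''])⟩

/-- Packing: pairwise disjoint flats each carrying weight `≥ μ` inside `D` carry total weight `≥ Σμ` inside `D`.
[folklore] -/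
theorem sum_mu_le (L : List FlatRec) (D : Finset ℕ) (v : ℕ → ℤ)
    (hpw : L.Pairwise fun c c' => Disjoint (fset c) (fset c'))
    (hC : ∀ c ∈ L, mu c ≤ ∑ y ∈ fset c ∩ D, v y) :
    (L.map mu).sum ≤ ∑ y ∈ flatUnion L ∩ D, v y := by
  induction L with
  | nil => simp [flatUnion]
  | cons c L ih =>
    rw [List.pairwise_cons] at hpw
    have hsplit : (fset c ∪ flatUnion L) ∩ D = (fset c ∩ D) ∪ (flatUnion L ∩ D) :=
      union_inter_distrib_right _ _ _
    have hdj : Disjoint (fset c ∩ D) (flatUnion L ∩ D) :=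
      (disjoint_flatUnion c L hpw.1).mono inter_subset_left inter_subset_left
    rw [List.map_cons, List.sum_cons, flatUnion, hsplit, sum_union hdj]
    exact add_le_add (hC c (by simp)) (ih hpw.2 fun c' hc' => hC c' (by simp [hc']))

/-- **Soundness of weighted flat packing**: a passing certificate bounds the forrelation sum of EVERY cubic `f`
against `g` by `T`. [cite: MacWilliamsSloane1977, Ch. 13 §3] -/
theorem fsumZ_le_of_packCheck {n : ℕ} {g : (Fin n → Bool) → Bool} {T : ℤ} {cert : List FlatRec}
    (h : packCheck n g T cert = true) (f : (Fin n → Bool) → Bool) (hf : IsDegLeFun 3 f) :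
    fsumZ n f g ≤ T := by
  simp only [packCheck, Bool.and_eq_true, List.all_eq_true, List.mem_range, decide_eq_true_eq,
    List.getElem?_toArray] at h
  obtain ⟨⟨⟨⟨hlt, hsupp⟩, hpar⟩, hdis⟩, hbud⟩ := h
  -- table lookups are Walsh values
  have hw : ∀ y, y < 2 ^ n → (wal n (sigTable n g))[y]?.getD 0 = wspec n g y := fun y hy => wal_sigTable n g y hy
  -- flat points are codes `< 2^n`
  have hcode : ∀ c ∈ cert, ∀ e, fcode c e < 2 ^ n := by
    intro c hc e
    obtain ⟨⟨⟨⟨h0, h1⟩, h2⟩, h3⟩, h4⟩ := hlt c hc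
    have hi : ∀ (b : Bool) (d : ℕ), d < 2 ^ n → (if b then d else 0) < 2 ^ n := fun b d hd => by
      cases b
      · exact Nat.two_pow_pos n
      · exact hd
    exact Nat.xor_lt_two_pow h0 (Nat.xor_lt_two_pow (hi _ _ h1) (Nat.xor_lt_two_pow (hi _ _ h2)
      (Nat.xor_lt_two_pow (hi _ _ h3) (hi _ _ h4))))
  -- signs and the disagreement set
  set w : ℕ → ℤ := wspec n g with hw_def
  set s : ℕ → ℤ := fun y => sgnZ (f (pt n y)) with hs_def
  have hs1 : ∀ y, s y = 1 ∨ s y = -1 := fun y => by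
    simp only [hs_def, sgnZ]; cases f (pt n y) <;> simp
  set Dis : Finset ℕ := (range (2 ^ n)).filter fun y => s y * w y < 0 with hDis_def
  -- (A) the forrelation sum is capacity minus twice the disagreement weight
  have hA : fsumZ n f g = (∑ y ∈ range (2 ^ n), |w y|) - 2 * ∑ y ∈ Dis, |w y| := by
    rw [fsumZ, hDis_def, sum_filter, mul_sum, ← sum_sub_distrib]
    exact sum_congr rfl fun y _ => sign_mul_eq (s y) (w y) (hs1 y)
  -- (C) every packed flat meets the disagreement set with weight at least `μ`
  have hC : ∀ c ∈ cert, mu c ≤ ∑ y ∈ fset c ∩ Dis, |w y| := by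
    intro c hc
    have hex : ∃ e, e < 16 ∧ s (fcode c e) * w (fcode c e) < 0 := by
      by_contra hne
      push Not at hne
      -- no disagreement on the flat: `f` follows the sign of `W` there
      have hfe : ∀ e, e < 16 →
          ((if f (pt n (fcode c e)) = true then 1 else 0 : ℕ) = if w (fcode c e) < 0 then 1 else 0) := by
        intro e he
        have h0 := hne e he
        have hnz : w (fcode c e) ≠ 0 := by
          have := (hsupp c hc e he).1; rwa [hw _ (hcode c hc e)] at this
        have hsy := hs1 (fcode c e)
        simp only [hs_def, sgnZ] at h0 hsy ⊢
        cases hfx : f (pt n (fcode c e))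
        · rw [hfx] at h0; simp only [Bool.false_eq_true, if_false, one_mul] at h0 ⊢
          rw [if_neg (not_lt.mpr h0)]
        · rw [hfx] at h0; simp only [if_true, neg_mul, one_mul, Left.nonneg_neg_iff] at h0 ⊢
          rw [if_pos (lt_of_le_of_ne h0 hnz)]
      have hev := even_card_fpt f hf c
      rw [card_fpt_eq_sum, sum_congr rfl fun e he => hfe e (mem_range.1 he)] at hev
      have hodd := hpar c hc
      rw [sum_congr rfl fun e he => by rw [hw _ (hcode c hc e)]] at hodd
      obtain ⟨r, hr⟩ := hev
      omega
    obtain ⟨e0, he0, hneg⟩ := hex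
    have hmem : fcode c e0 ∈ fset c ∩ Dis := by
      rw [mem_inter, fset, mem_image, hDis_def, mem_filter, mem_range]
      exact ⟨⟨e0, mem_range.2 he0, rfl⟩, hcode c hc e0, hneg⟩
    calc mu c ≤ |w (fcode c e0)| := by
          have := (hsupp c hc e0 he0).2; rwa [hw _ (hcode c hc e0)] at this
      _ ≤ ∑ y ∈ fset c ∩ Dis, |w y| :=
          single_le_sum (f := fun y => |w y|) (fun y _ => abs_nonneg _) hmem
  -- (B) disjoint flats: total loss at least `Σ μ`
  have hB : (cert.map mu).sum ≤ ∑ y ∈ Dis, |w y| :=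
    (sum_mu_le cert Dis (fun y => |w y|) hdis hC).trans
      (sum_le_sum_of_subset_of_nonneg inter_subset_right fun y _ _ => abs_nonneg _)
  -- the budget
  rw [sum_congr rfl fun y hy => by rw [hw y (mem_range.1 hy)]] at hbud
  rw [hA]
  linarith

/-- **Forrelation bound from a packing certificate** (`n = m + m`): `Φ(f,g) ≤ T / 2^{3m}` for all cubic `f`.
[cite: AaronsonAmbainis2018, §1.1.1] -/
theorem forrelation_le_of_packCheck (m : ℕ) {g : (Fin (m + m) → Bool) → Bool} {T : ℤ} {cert : List FlatRec}
    (h : packCheck (m + m) g T cert = true) (f : (Fin (m + m) → Bool) → Bool) (hf : IsDegLeFun 3 f) :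
    forrelation f g ≤ (T : ℝ) / (2 : ℝ) ^ (3 * m) := by
  have hpos : (0 : ℝ) < (2 : ℝ) ^ (3 * m) := by positivity
  rw [le_div_iff₀ hpos, forrelation_mul_eq_fsumZ]
  exact_mod_cast fsumZ_le_of_packCheck h f hf

/-! ### Capacity read-off -/

/-- The capacity checker: `Σ_y |W_g(y)|` read off the fast Walsh table equals `C`. [folklore] -/
def capCheck (n : ℕ) (g : (Fin n → Bool) → Bool) (C : ℤ) : Bool :=
  let w := (wal n (sigTable n g)).toArray
  decide ((∑ y ∈ range (2 ^ n), |w[y]?.getD 0|) = C)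

/-- Soundness of the capacity checker. [folklore] -/
theorem cap_eq_of_capCheck {n : ℕ} {g : (Fin n → Bool) → Bool} {C : ℤ} (h : capCheck n g C = true) :
    (∑ y ∈ range (2 ^ n), |wspec n g y|) = C := by
  simp only [capCheck, decide_eq_true_eq, List.getElem?_toArray] at h
  rw [sum_congr rfl fun y hy => by rw [wal_sigTable n g y (mem_range.1 hy)]] at h
  exact h

end Summit.QuantumAdvantage.QuantumAdvantage.Theorems.NearExactIsExact.Negative.FlatPacking
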